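import Summits.AtomisticToContinuum.FouriersLaw.Theses.EmbeddedDrudeMourre
import Literature.MathematicalPhysics.KineticTheory.InfiniteChainInvariantStates
import Literature.MathematicalPhysics.KineticTheory.InfiniteChainObservables
import Literature.MathematicalPhysics.KineticTheory.LangevinChainSDE
import Literature.MathematicalPhysics.KineticTheory.LangevinChainNESSProofs
import Summits.AtomisticToContinuum.FouriersLaw.Theorems.ParityLiouvilleSeedLiouvilleForHeatOrbitMeasure
import HarnessLib

/-!
# Stub C `stub_pencilDerivation`, part (i): the Liouville derivation on local polynomials
(line `gram-pencil-harmonic-chaos`, crux `EmbeddedDrudeMourre.DrudeDissolution`,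
item stmt-AtomisticToContinuum-12593; `--supports` file, closes nothing)

WHAT. The algebra `𝒫 = Algebra.adjoin ℝ {σ ↦ q_x, σ ↦ p_x}` of LOCAL POLYNOMIAL observables of the
infinite chain (`q_x = (σ x).1`, `p_x = (σ x).2`) is mapped into itself by the Liouville operator
`liouvilleZ (pinnedChain ω₂ lam β γ)` (registered sub-goal `stub_pencilDerivation_algebra` = conjunct (i)
of stub C), together with the reusable calculus behind it:

* every `u ∈ 𝒫` is `σ ↦ eval (i ↦ X_{e i}(σ)) q` for a polynomial `q` in finitely many letters
  (`mem_localPolynomials_iff`);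
* the chain rule for `MvPolynomial.eval` along a coordinatewise differentiable path
  (`hasDerivAt_mvPolynomial_eval_path`);
* `partialQZ`, `partialPZ` and `liouvilleZ P` of such an observable are FINITE sums with polynomial
  partial derivatives (`liouvilleZ_localPolynomial_apply`, any chain `P`);
* the chain rule along solutions of the equations of motion, `d/dt u(γ t) = (liouvilleZ P u)(γ t)`
  (`hasDerivAt_localPolynomial_comp_of_isSolution`, any chain `P`), and continuity of local polynomials.

WHY. Stub C of the line puts the pencil `𝓛_ε = liouvilleZ P_ε` on ONE ε-independent algebra `𝒫`; (i) is
its algebraic half. Proof: `Algebra.adjoin_range_eq_range_aeval` + `MvPolynomial.exists_fin_rename`;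
the `tsum` over sites in `liouvilleZ` is a finite sum because both partial derivatives vanish off the
finitely many sites read by `u`; the forces of `pinnedChain` are polynomials in `q_{x-1}, q_x, q_{x+1}`.
-/

noncomputable section

open MeasureTheory Filter Set Function Topology
open scoped InnerProductSpace ENNReal
open Literature.MathematicalPhysics.KineticTheory
open Literature.MathematicalPhysics.KineticTheory.HeatConduction
open MvPolynomial

namespace Summit.AtomisticToContinuum.FouriersLaw.Theorems.DrudeDissolution.GramPencilHarmonicChaos

/-! ## Calculus of `MvPolynomial.eval` -/

/-- **Chain rule for polynomial evaluation along a path**: if every coordinate `t ↦ c t i` has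
derivative `c' i` at `t₀`, then `t ↦ eval (c t) p` has derivative `∑ i, c' i · (∂_i p)(c t₀)`.
[folklore] -/
theorem hasDerivAt_mvPolynomial_eval_path {ι : Type*} [Fintype ι] [DecidableEq ι]
    (p : MvPolynomial ι ℝ) {c : ℝ → ι → ℝ} {c' : ι → ℝ} {t₀ : ℝ}
    (hc : ∀ i, HasDerivAt (fun t => c t i) (c' i) t₀) :
    HasDerivAt (fun t => eval (c t) p) (∑ i, c' i * eval (c t₀) (pderiv i p)) t₀ := by
  induction p using MvPolynomial.induction_on with
  | C a =>
    simp only [eval_C, pderiv_C, map_zero, mul_zero, Finset.sum_const_zero]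
    exact hasDerivAt_const _ _
  | add p q hp hq =>
    simp only [map_add, mul_add, Finset.sum_add_distrib]
    exact hp.add hq
  | mul_X p j hp =>
    simp only [map_mul, eval_X]
    have h := hp.mul (hc j)
    have hsum : ∑ i, c' i * eval (c t₀) (pderiv i (p * X j)) =
        (∑ i, c' i * eval (c t₀) (pderiv i p)) * c t₀ j + eval (c t₀) p * c' j := by
      have h1 : ∀ i, eval (c t₀) (pderiv i (p * X j)) =
          eval (c t₀) (pderiv i p) * c t₀ j + eval (c t₀) p * (if j = i then 1 else 0) := by
        intro i
        rw [pderiv_mul, map_add, map_mul, map_mul, eval_X, pderiv_X, Pi.single_apply]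
        split_ifs <;> simp
      simp_rw [h1, mul_add, Finset.sum_add_distrib, Finset.sum_mul]
      congr 1
      · exact Finset.sum_congr rfl fun i _ => by ring
      · rw [Finset.sum_eq_single j]
        · simp only [if_true, mul_one]
          ring
        · intro i _ hij
          simp [Ne.symm hij]
        · intro hj; exact absurd (Finset.mem_univ j) hj
    rw [hsum]
    exact h

/-- Evaluating `aeval Y q` (values in the function algebra `ChainConfig → ℝ`) at a configuration is
evaluating `q` at the point `i ↦ Y i σ`. [folklore] -/
theorem mvPolynomial_aeval_apply {ι : Type*} (Y : ι → ChainConfig → ℝ) (q : MvPolynomial ι ℝ)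
    (σ : ChainConfig) : (aeval Y q) σ = eval (fun i => Y i σ) q := by
  have h := MvPolynomial.comp_aeval Y (Pi.evalAlgHom ℝ (fun _ : ChainConfig => ℝ) σ)
  have h2 := congrArg (fun φ : MvPolynomial ι ℝ →ₐ[ℝ] ℝ => φ q) h
  simpa using h2

/-- Local polynomials are continuous on `ChainConfig` (product topology). [folklore] -/
theorem continuous_localPolynomial {n : ℕ} (e : Fin n → ℤ × Bool) (q : MvPolynomial (Fin n) ℝ) :
    Continuous fun σ : ChainConfig => eval (fun i => (if (e i).2 then (σ (e i).1).2 else (σ (e i).1).1)) q := by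
  refine (MvPolynomial.continuous_eval q).comp (continuous_pi fun i => ?_)
  by_cases h : (e i).2
  · simp only [h, if_true]
    exact (continuous_apply (e i).1).snd
  · simp only [h]
    exact (continuous_apply (e i).1).fst

/-! ## The algebra `𝒫` of local polynomials -/

/-- **Normal form of local polynomials**: `u ∈ 𝒫 = Algebra.adjoin ℝ {q_x, p_x}` iff
`u σ = eval (i ↦ X_{e i} σ) q` for some `n`, letters `e : Fin n → ℤ × Bool` and `q ∈ ℝ[Fin n]`.
[folklore] -/
theorem mem_localPolynomials_iff (u : ChainConfig → ℝ) :
    u ∈ Algebra.adjoin ℝ (Set.range (fun xc : ℤ × Bool => fun σ : ChainConfig => if xc.2 then (σ xc.1).2 else (σ xc.1).1)) ↔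
      ∃ (n : ℕ) (e : Fin n → ℤ × Bool) (q : MvPolynomial (Fin n) ℝ),
        u = fun σ => eval (fun i => (if (e i).2 then (σ (e i).1).2 else (σ (e i).1).1)) q := by
  constructor
  · intro hu
    have hu' := hu
    rw [Algebra.adjoin_range_eq_range_aeval, AlgHom.mem_range] at hu'
    obtain ⟨p, rfl⟩ := hu'
    obtain ⟨n, f, _, q, rfl⟩ := exists_fin_rename p
    refine ⟨n, f, q, ?_⟩
    funext σ
    rw [aeval_rename, mvPolynomial_aeval_apply]
    rfl
  · rintro ⟨n, e, q, rfl⟩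
    have hq : (fun σ => eval (fun i => (if (e i).2 then (σ (e i).1).2 else (σ (e i).1).1)) q) = aeval ((fun xc : ℤ × Bool => fun σ : ChainConfig => if xc.2 then (σ xc.1).2 else (σ xc.1).1) ∘ e) q := by
      funext σ
      rw [mvPolynomial_aeval_apply]
      rfl
    rw [hq]
    have hsub : Algebra.adjoin ℝ (Set.range ((fun xc : ℤ × Bool => fun σ : ChainConfig => if xc.2 then (σ xc.1).2 else (σ xc.1).1) ∘ e)) ≤ Algebra.adjoin ℝ (Set.range (fun xc : ℤ × Bool => fun σ : ChainConfig => if xc.2 then (σ xc.1).2 else (σ xc.1).1)) :=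
      Algebra.adjoin_mono (Set.range_comp_subset_range e (fun xc : ℤ × Bool => fun σ : ChainConfig => if xc.2 then (σ xc.1).2 else (σ xc.1).1))
    refine hsub ?_
    rw [Algebra.adjoin_range_eq_range_aeval]
    exact ⟨q, rfl⟩

/-- The coordinates `q_x`, `p_x` are local polynomials. [folklore] -/
theorem coord_mem_localPolynomials (xc : ℤ × Bool) :
    (fun σ : ChainConfig => if xc.2 then (σ xc.1).2 else (σ xc.1).1) ∈ Algebra.adjoin ℝ (Set.range (fun xc : ℤ × Bool => fun σ : ChainConfig => if xc.2 then (σ xc.1).2 else (σ xc.1).1)) :=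
  Algebra.subset_adjoin ⟨xc, rfl⟩

/-- `σ ↦ q_x` is a local polynomial. [folklore] -/
theorem position_mem_localPolynomials (x : ℤ) :
    (fun σ : ChainConfig => (σ x).1) ∈ Algebra.adjoin ℝ (Set.range (fun xc : ℤ × Bool => fun σ : ChainConfig => if xc.2 then (σ xc.1).2 else (σ xc.1).1)) := by
  simpa using coord_mem_localPolynomials (x, false)

/-- `σ ↦ p_x` is a local polynomial. [folklore] -/
theorem momentum_mem_localPolynomials (x : ℤ) :
    (fun σ : ChainConfig => (σ x).2) ∈ Algebra.adjoin ℝ (Set.range (fun xc : ℤ × Bool => fun σ : ChainConfig => if xc.2 then (σ xc.1).2 else (σ xc.1).1)) := by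
  simpa using coord_mem_localPolynomials (x, true)

/-- The partial derivatives `σ ↦ (∂_i q)(X_e σ)` of a local polynomial are local polynomials. [folklore] -/
theorem eval_pderiv_mem_localPolynomials {n : ℕ} (e : Fin n → ℤ × Bool) (q : MvPolynomial (Fin n) ℝ)
    (i : Fin n) :
    (fun σ : ChainConfig => eval (fun j => (if (e j).2 then (σ (e j).1).2 else (σ (e j).1).1)) (pderiv i q)) ∈ Algebra.adjoin ℝ (Set.range (fun xc : ℤ × Bool => fun σ : ChainConfig => if xc.2 then (σ xc.1).2 else (σ xc.1).1)) :=
  (mem_localPolynomials_iff _).2 ⟨n, e, pderiv i q, rfl⟩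

/-! ## Partial derivatives and the Liouville operator of a local polynomial -/

/-- The coordinate `X_{xc}` of an updated configuration. [folklore] -/
theorem coord_update (xc : ℤ × Bool) (σ : ChainConfig) (x : ℤ) (v : ℝ × ℝ) :
    (if xc.2 then (Function.update σ x v xc.1).2 else (Function.update σ x v xc.1).1) =
      if xc.1 = x then (if xc.2 then v.2 else v.1) else (if xc.2 then (σ xc.1).2 else (σ xc.1).1) := by
  by_cases h : xc.1 = x
  · subst h
    simp
  · simp [h]

/-- `∂_{q_x}` of a local polynomial: `∑ i, [e i = (x, q)] (∂_i q)(X_e σ)`. [folklore] -/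
theorem partialQZ_localPolynomial {n : ℕ} (e : Fin n → ℤ × Bool) (q : MvPolynomial (Fin n) ℝ)
    (x : ℤ) (σ : ChainConfig) :
    partialQZ x (fun σ => eval (fun i => (if (e i).2 then (σ (e i).1).2 else (σ (e i).1).1)) q) σ =
      ∑ i, (if e i = (x, false) then (1 : ℝ) else 0) * eval (fun i => (if (e i).2 then (σ (e i).1).2 else (σ (e i).1).1)) (pderiv i q) := by
  unfold partialQZ
  have hc : ∀ i, HasDerivAt (fun t : ℝ => (if (e i).2 then (Function.update σ x (t, (σ x).2) (e i).1).2 else (Function.update σ x (t, (σ x).2) (e i).1).1))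
      (if e i = (x, false) then (1 : ℝ) else 0) (σ x).1 := by
    intro i
    simp only [coord_update]
    by_cases h1 : (e i).1 = x
    · by_cases h2 : (e i).2
      · have hne : e i ≠ (x, false) := fun h => by simp [h] at h2
        simp only [h1, h2, if_true, hne, if_false]
        exact hasDerivAt_const _ _
      · have heq : e i = (x, false) := Prod.ext h1 (by simpa using h2)
        simp only [if_true, heq]
        exact hasDerivAt_id _
    · have hne : e i ≠ (x, false) := fun h => h1 (by simp [h])
      simp only [h1, if_false, hne]
      exact hasDerivAt_const _ _
  have h := hasDerivAt_mvPolynomial_eval_path q hc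
  have hpt : (fun i => (if (e i).2 then (Function.update σ x ((σ x).1, (σ x).2) (e i).1).2 else (Function.update σ x ((σ x).1, (σ x).2) (e i).1).1)) = fun i => (if (e i).2 then (σ (e i).1).2 else (σ (e i).1).1) := by
    rw [Prod.mk.eta, Function.update_eq_self]
  rw [hpt] at h
  exact h.deriv

/-- `∂_{p_x}` of a local polynomial: `∑ i, [e i = (x, p)] (∂_i q)(X_e σ)`. [folklore] -/
theorem partialPZ_localPolynomial {n : ℕ} (e : Fin n → ℤ × Bool) (q : MvPolynomial (Fin n) ℝ)
    (x : ℤ) (σ : ChainConfig) :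
    partialPZ x (fun σ => eval (fun i => (if (e i).2 then (σ (e i).1).2 else (σ (e i).1).1)) q) σ =
      ∑ i, (if e i = (x, true) then (1 : ℝ) else 0) * eval (fun i => (if (e i).2 then (σ (e i).1).2 else (σ (e i).1).1)) (pderiv i q) := by
  unfold partialPZ
  have hc : ∀ i, HasDerivAt (fun t : ℝ => (if (e i).2 then (Function.update σ x ((σ x).1, t) (e i).1).2 else (Function.update σ x ((σ x).1, t) (e i).1).1))
      (if e i = (x, true) then (1 : ℝ) else 0) (σ x).2 := by
    intro i
    simp only [coord_update]
    by_cases h1 : (e i).1 = x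
    · by_cases h2 : (e i).2
      · have heq : e i = (x, true) := Prod.ext h1 (by simpa using h2)
        simp only [if_true, heq]
        exact hasDerivAt_id _
      · have hne : e i ≠ (x, true) := fun h => by simp [h] at h2
        simp only [h1, h2, if_true, hne, if_false, Bool.false_eq_true]
        exact hasDerivAt_const _ _
    · have hne : e i ≠ (x, true) := fun h => h1 (by simp [h])
      simp only [h1, if_false, hne]
      exact hasDerivAt_const _ _
  have h := hasDerivAt_mvPolynomial_eval_path q hc
  have hpt : (fun i => (if (e i).2 then (Function.update σ x ((σ x).1, (σ x).2) (e i).1).2 else (Function.update σ x ((σ x).1, (σ x).2) (e i).1).1)) = fun i => (if (e i).2 then (σ (e i).1).2 else (σ (e i).1).1) := by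
    rw [Prod.mk.eta, Function.update_eq_self]
  rw [hpt] at h
  exact h.deriv

/-- **The Liouville operator of a local polynomial is a finite sum** (any chain `P`):
`𝒜u(σ) = ∑ i, c_i(σ) (∂_i q)(X_e σ)` with `c_i = F_{x}` if the letter `e i` is `p_x` and `c_i = p_x`
if it is `q_x`. [folklore] -/
theorem liouvilleZ_localPolynomial_apply (P : OscillatorChain) {n : ℕ} (e : Fin n → ℤ × Bool)
    (q : MvPolynomial (Fin n) ℝ) (σ : ChainConfig) :
    liouvilleZ P (fun σ => eval (fun i => (if (e i).2 then (σ (e i).1).2 else (σ (e i).1).1)) q) σ =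
      ∑ i, (if (e i).2 then P.force σ (e i).1 else (σ (e i).1).2) *
        eval (fun i => (if (e i).2 then (σ (e i).1).2 else (σ (e i).1).1)) (pderiv i q) := by
  classical
  unfold liouvilleZ
  simp_rw [partialQZ_localPolynomial, partialPZ_localPolynomial]
  set ev : Fin n → ℝ := fun i => eval (fun i => (if (e i).2 then (σ (e i).1).2 else (σ (e i).1).1)) (pderiv i q) with hev
  set s : Finset ℤ := Finset.univ.image fun i => (e i).1 with hs
  rw [tsum_eq_sum (s := s)]
  · -- rearrange the double sum
    have h1 : ∀ x ∈ s, (σ x).2 * ∑ i, (if e i = (x, false) then (1 : ℝ) else 0) * ev i +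
        P.force σ x * ∑ i, (if e i = (x, true) then (1 : ℝ) else 0) * ev i =
        ∑ i, ((if e i = (x, false) then (σ x).2 else 0) + (if e i = (x, true) then P.force σ x else 0)) *
          ev i := by
      intro x _
      rw [Finset.mul_sum, Finset.mul_sum, ← Finset.sum_add_distrib]
      refine Finset.sum_congr rfl fun i _ => ?_
      split_ifs <;> ring
    rw [Finset.sum_congr rfl h1, Finset.sum_comm]
    refine Finset.sum_congr rfl fun i _ => ?_
    rw [← Finset.sum_mul]
    congr 1
    rw [Finset.sum_eq_single (e i).1]
    · cases h : (e i).2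
      · have heq : e i = ((e i).1, false) := Prod.ext rfl h
        have hne : e i ≠ ((e i).1, true) := fun h' => by rw [h'] at h; simp at h
        rw [if_pos heq, if_neg hne]
        simp
      · have heq : e i = ((e i).1, true) := Prod.ext rfl h
        have hne : e i ≠ ((e i).1, false) := fun h' => by rw [h'] at h; simp at h
        rw [if_neg hne, if_pos heq]
        simp
    · intro x _ hx
      have h1 : e i ≠ (x, false) := fun h' => hx (by rw [h'])
      have h2 : e i ≠ (x, true) := fun h' => hx (by rw [h'])
      rw [if_neg h1, if_neg h2, add_zero]
    · intro hi
      exact absurd (Finset.mem_image_of_mem (fun i => (e i).1) (Finset.mem_univ i)) hi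
  · intro x hx
    have hx' : ∀ i, (e i).1 ≠ x := fun i h => hx (Finset.mem_image.2 ⟨i, Finset.mem_univ _, h⟩)
    have h1 : ∀ i, e i ≠ (x, false) := fun i h => hx' i (by rw [h])
    have h2 : ∀ i, e i ≠ (x, true) := fun i h => hx' i (by rw [h])
    simp [h1, h2]

/-- **Chain rule along solutions of the equations of motion** (any chain `P`): for a local
polynomial `u` and a solution `γ` of `q̇ = p`, `ṗ = F`, `d/dt u(γ t) = (liouvilleZ P u)(γ t)`.
[folklore] -/
theorem hasDerivAt_localPolynomial_comp_of_isSolution (P : OscillatorChain) {n : ℕ}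
    (e : Fin n → ℤ × Bool) (q : MvPolynomial (Fin n) ℝ) {γ : ℝ → ChainConfig} (hγ : P.IsSolution γ)
    (t : ℝ) :
    HasDerivAt (fun s => eval (fun i => (if (e i).2 then (γ s (e i).1).2 else (γ s (e i).1).1)) q)
      (liouvilleZ P (fun σ => eval (fun i => (if (e i).2 then (σ (e i).1).2 else (σ (e i).1).1)) q) (γ t)) t := by
  classical
  rw [liouvilleZ_localPolynomial_apply]
  refine hasDerivAt_mvPolynomial_eval_path q (c := fun s i => (if (e i).2 then (γ s (e i).1).2 else (γ s (e i).1).1)) fun i => ?_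
  by_cases h : (e i).2
  · simp only [h, if_true]
    exact (hγ (e i).1 t).2
  · simp only [h]
    exact (hγ (e i).1 t).1

/-! ## Conjunct (i): `liouvilleZ (pinnedChain ω₂ lam β γ)` maps `𝒫` into `𝒫` -/

/-- **The forces of `pinnedChain` are local polynomials** (in `q_{x-1}, q_x, q_{x+1}`). [folklore] -/
theorem force_pinnedChain_mem_localPolynomials (ω₂ lam β γ : ℝ) (x : ℤ) :
    (fun σ : ChainConfig => (pinnedChain ω₂ lam β γ).force σ x) ∈ Algebra.adjoin ℝ (Set.range (fun xc : ℤ × Bool => fun σ : ChainConfig => if xc.2 then (σ xc.1).2 else (σ xc.1).1)) := by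
  set A := Algebra.adjoin ℝ (Set.range (fun xc : ℤ × Bool => fun σ : ChainConfig => if xc.2 then (σ xc.1).2 else (σ xc.1).1)) with hA
  set Q : ℤ → ChainConfig → ℝ := fun y σ => (σ y).1 with hQ
  have hQm : ∀ y, Q y ∈ A := fun y => position_mem_localPolynomials y
  have hF : (fun σ : ChainConfig => (pinnedChain ω₂ lam β γ).force σ x) =
      -(ω₂ • Q x + lam • (Q x * Q x * Q x)) +
        ((Q (x + 1) - Q x) + β • ((Q (x + 1) - Q x) * (Q (x + 1) - Q x) * (Q (x + 1) - Q x))) -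
        ((Q x - Q (x - 1)) + β • ((Q x - Q (x - 1)) * (Q x - Q (x - 1)) * (Q x - Q (x - 1)))) := by
    funext σ
    simp only [OscillatorChain.force, OscillatorChain.interactionForce, pinnedChain_deriv_U,
      pinnedChain_deriv_V, hQ, Pi.add_apply, Pi.neg_apply, Pi.sub_apply, Pi.smul_apply, Pi.mul_apply,
      smul_eq_mul]
    ring
  rw [hF]
  refine A.sub_mem (A.add_mem (A.neg_mem (A.add_mem (A.smul_mem (hQm x) _)
    (A.smul_mem (A.mul_mem (A.mul_mem (hQm x) (hQm x)) (hQm x)) _))) (A.add_mem ?_ (A.smul_mem ?_ _)))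
    (A.add_mem ?_ (A.smul_mem ?_ _))
  · exact A.sub_mem (hQm _) (hQm _)
  · exact A.mul_mem (A.mul_mem (A.sub_mem (hQm _) (hQm _)) (A.sub_mem (hQm _) (hQm _)))
      (A.sub_mem (hQm _) (hQm _))
  · exact A.sub_mem (hQm _) (hQm _)
  · exact A.mul_mem (A.mul_mem (A.sub_mem (hQm _) (hQm _)) (A.sub_mem (hQm _) (hQm _)))
      (A.sub_mem (hQm _) (hQm _))

/-- The Liouville operator of `pinnedChain` maps a local polynomial in normal form into `𝒫`. [folklore] -/
theorem liouvilleZ_localPolynomial_mem (ω₂ lam β γ : ℝ) {n : ℕ} (e : Fin n → ℤ × Bool)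
    (q : MvPolynomial (Fin n) ℝ) :
    liouvilleZ (pinnedChain ω₂ lam β γ) (fun σ => eval (fun i => (if (e i).2 then (σ (e i).1).2 else (σ (e i).1).1)) q) ∈
      Algebra.adjoin ℝ (Set.range (fun xc : ℤ × Bool => fun σ : ChainConfig => if xc.2 then (σ xc.1).2 else (σ xc.1).1)) := by
  set A := Algebra.adjoin ℝ (Set.range (fun xc : ℤ × Bool => fun σ : ChainConfig => if xc.2 then (σ xc.1).2 else (σ xc.1).1)) with hA
  have hfun : liouvilleZ (pinnedChain ω₂ lam β γ) (fun σ => eval (fun i => (if (e i).2 then (σ (e i).1).2 else (σ (e i).1).1)) q) =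
      ∑ i, (fun σ : ChainConfig => if (e i).2 then (pinnedChain ω₂ lam β γ).force σ (e i).1
          else (σ (e i).1).2) *
        (fun σ : ChainConfig => eval (fun j => (if (e j).2 then (σ (e j).1).2 else (σ (e j).1).1)) (pderiv i q)) := by
    funext σ
    rw [liouvilleZ_localPolynomial_apply, Finset.sum_apply]
    rfl
  rw [hfun]
  refine A.sum_mem fun i _ => A.mul_mem ?_ (eval_pderiv_mem_localPolynomials e q i)
  cases h : (e i).2
  · simpa using momentum_mem_localPolynomials (e i).1
  · simpa using force_pinnedChain_mem_localPolynomials ω₂ lam β γ (e i).1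

/-- **Stub C, conjunct (i)** (registered sub-goal `stub_pencilDerivation_algebra`): the Liouville
operator of `pinnedChain ω₂ lam β γ` maps the algebra of local polynomials into itself. -/
theorem stub_pencilDerivation_algebra : ∀ ω₂ lam β γ : ℝ, ∀ u ∈ Algebra.adjoin ℝ (Set.range fun xc : ℤ × Bool => fun σ : Literature.MathematicalPhysics.KineticTheory.HeatConduction.ChainConfig => if xc.2 then (σ xc.1).2 else (σ xc.1).1), Literature.MathematicalPhysics.KineticTheory.HeatConduction.liouvilleZ (Literature.MathematicalPhysics.KineticTheory.HeatConduction.pinnedChain ω₂ lam β γ) u ∈ Algebra.adjoin ℝ (Set.range fun xc : ℤ × Bool => fun σ : Literature.MathematicalPhysics.KineticTheory.HeatConduction.ChainConfig => if xc.2 then (σ xc.1).2 else (σ xc.1).1) := by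
  intro ω₂ lam β γ u hu
  obtain ⟨n, e, q, rfl⟩ := (mem_localPolynomials_iff u).1 hu
  exact liouvilleZ_localPolynomial_mem ω₂ lam β γ e q


/-! ## Orbits: continuity and the fundamental theorem of calculus along the flow -/

/-- Local polynomials are continuous. [folklore] -/
theorem continuous_of_mem_localPolynomials {u : ChainConfig → ℝ}
    (hu : u ∈ Algebra.adjoin ℝ (Set.range (fun xc : ℤ × Bool => fun σ : ChainConfig =>
      if xc.2 then (σ xc.1).2 else (σ xc.1).1))) : Continuous u := by
  obtain ⟨n, e, q, rfl⟩ := (mem_localPolynomials_iff u).1 hu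
  exact continuous_localPolynomial e q

/-- **Chain rule along the flow**: for a local polynomial `u`, a dynamics `D` of any chain `P` and
`σ` in its carrier, `d/ds u(φ_s σ) = (liouvilleZ P u)(φ_s σ)`. [folklore] -/
theorem hasDerivAt_comp_flow_of_mem_localPolynomials {P : OscillatorChain} (D : InfiniteChainDynamics P)
    {u : ChainConfig → ℝ}
    (hu : u ∈ Algebra.adjoin ℝ (Set.range (fun xc : ℤ × Bool => fun σ : ChainConfig =>
      if xc.2 then (σ xc.1).2 else (σ xc.1).1)))
    {σ : ChainConfig} (hσ : σ ∈ D.carrier) (s : ℝ) :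
    HasDerivAt (fun s => u (D.flow s σ)) (liouvilleZ P u (D.flow s σ)) s := by
  obtain ⟨n, e, q, rfl⟩ := (mem_localPolynomials_iff u).1 hu
  exact hasDerivAt_localPolynomial_comp_of_isSolution P e q (D.isSolution σ hσ) s

/-- **FTC along the flow of `pinnedChain`**: for a local polynomial `u` and `σ` in the carrier,
`u(φ_t σ) - u(σ) = ∫₀ᵗ (liouvilleZ P u)(φ_s σ) ds`. [folklore] -/
theorem localPolynomial_comp_flow_sub_eq_integral {ω₂ lam β γ : ℝ}
    (D : InfiniteChainDynamics (pinnedChain ω₂ lam β γ)) {u : ChainConfig → ℝ}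
    (hu : u ∈ Algebra.adjoin ℝ (Set.range (fun xc : ℤ × Bool => fun σ : ChainConfig =>
      if xc.2 then (σ xc.1).2 else (σ xc.1).1)))
    {σ : ChainConfig} (hσ : σ ∈ D.carrier) (t : ℝ) :
    u (D.flow t σ) - u σ =
      ∫ s in (0 : ℝ)..t, liouvilleZ (pinnedChain ω₂ lam β γ) u (D.flow s σ) := by
  have hc : Continuous fun s => liouvilleZ (pinnedChain ω₂ lam β γ) u (D.flow s σ) :=
    (continuous_of_mem_localPolynomials (stub_pencilDerivation_algebra ω₂ lam β γ u hu)).comp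
      (ParityLiouvilleSeed.continuous_of_isSolution (D.isSolution σ hσ))
  rw [intervalIntegral.integral_eq_sub_of_hasDerivAt
    (fun s _ => hasDerivAt_comp_flow_of_mem_localPolynomials D hu hσ s) (hc.intervalIntegrable 0 t),
    D.flow_zero σ hσ]

end Summit.AtomisticToContinuum.FouriersLaw.Theorems.DrudeDissolution.GramPencilHarmonicChaos

end
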